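import Literature.MathematicalPhysics.QuantumFieldTheory.Balaban1983to89.StrongCouplingOpenWindow
import Literature.MathematicalPhysics.QuantumFieldTheory.SU2HiggsKeyEstimate
import HarnessLib

/-!
# Strong-coupling variance window: the `SU(2)` one-link modulus `√(2/(1 − 2R))` and the `d = 4` window
# `81 β_W² + 6 β_W < 2` (`β_W ≤ 0.1244`), hypothesis-free, in the three currencies SC-a / SC-b / SC-c

HONEST FRAMING.  This file belongs to the «observatory of the non-perturbative crossover; no mass-gap claim»
(`ir/FRONT-SC.md`).  It sharpens the `SU(2)` one-link Kantorovich–Rubinstein modulus of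
`StrongCouplingKernelWindow` (J-SC5) by one lemma and moves the certified strong-coupling window of four-dimensional
`SU(2)` lattice Yang–Mills from `β_W ≤ 1/9` (`81β²(1+18β²+48β³) < 2(1−3β)`, sup `β_W = 0.11239`) to
`81 β_W² + 6 β_W < 2` (sup `β_W = (√684 − 6)/162 = 0.12440`); nothing is said about any `β_W` beyond that, and nothing
about the continuum.  Every statement is a kernel theorem about Mathlib's Haar probability measure; there are no
hypotheses, no named facts, no axioms; the inputs are TREE THEOREMS used by name.  The cited literature is quoted as the
locus of the METHOD (Creutz's axis reduction of the one-link heat-bath law, the Ellis–Monroe–Newman variance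
monotonicity for even single-site laws, Shen–Zhu–Zhu's Dobrushin route), never as a hypothesis.

THE ONE NEW LEMMA (`integral_var_tilted_le`).  For the one-link law `ν_B = e^{F} σ / σ(e^{F})` of `SU(2)`,
`F(g) = 2 Re tr(g B)` with `|F| ≤ 1`, and a linear observable `w(g) = 2 Re tr(g Δ)`:
`Var_{ν_B}(w) ≤ ∫ w² dσ` — the variance under the tilt is at most the variance under Haar.  J-SC5 used instead
`Var_{ν_B}(w) ≤ E_{ν_B} w² ≤ (1 + κ²/2 + 2κ³/9) E_σ w²` (`κ = sup |F| = 4R`), and the growth factor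
`c(R) = 1 + 8R² + 128R³/9` is what this file removes: the modulus becomes `K(R) = √(2/(1 − 2R))` in place of
`√(2 c(R)/(1 − 2R))`.

PROOF OF THE LEMMA (Part B).  In the quaternion coordinates `x = (x₀, x₁, x₂, x₃) ∈ S³` of `g ∈ SU(2)`
(`QuantumLattice.su2Quat`), `Re tr(g M) = 2 Re(x · m_M)` is linear, Haar is invariant under `x ↦ p x q` for unit
quaternions `p, q` (left and right translation), and `F` depends on `x` through `Re(x · m_B)` only.  (1) AXIS
REDUCTION (Creutz's heat-bath rotation, (18.15)–(18.17)): right translation by the unit quaternion `y` with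
`y · m_B = |m_B|` turns `F` into `κ x₀`, `κ = 4|m_B| ≤ 1`, and `w` into another linear form `4 Re(x · m')` with
`|m'| = |m_Δ|`.  (2) ISOTROPY ((18.19)–(18.20): «the direction for **a** is totally random»): under the weight
`e^{κ x₀} dσ` the cross moments `∫ x₀^a x_i`, `∫ x_i x_j` (`1 ≤ i < j`) cancel (average over the conjugations by
`i`, `j`, `k`, each flipping the signs of two of `x₁, x₂, x₃`) and
`∫ x₁² = ∫ x₂² = ∫ x₃²` (conjugation by `ω = (1+i+j+k)/2`), so that
`∫ (Re(x·m) − m₀κ/4)² e^{κx₀} dσ = m₀² ∫ (x₀ − κ/4)² e^{κx₀} dσ + (m₁² + m₂² + m₃²) · (1/3) ∫ (1 − x₀²) e^{κx₀} dσ`.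
(3) THE TWO ONE-DIMENSIONAL INEQUALITIES for the marginal `(1 − t²)^{1/2} e^{κt} dt` of `x₀`, `0 ≤ κ ≤ 1`:
`∫ (x₀ − κ/4)² e^{κx₀} dσ ≤ (1/4) ∫ e^{κx₀} dσ` and `∫ x₀² e^{κx₀} dσ ≥ (1/4) ∫ e^{κx₀} dσ` — instances of the
Ellis–Monroe–Newman monotonicity of the variance of an even ferromagnetic single-site law in the field (their
Theorem 1.1 with Theorem 1.2(d): the density `(1 − t²)^{1/2}` has `g'/g = −t/(1 − t²)` concave on `[0, 1)`), proved
here from scratch by the fourth-order Taylor bound `|e^{s} − (1 + s + s²/2 + s³/6)| ≤ 5 s⁴/96` (`|s| ≤ 1`, Mathlib's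
`Real.exp_bound`) and the exact Haar moments `E x₀² = 1/4`, `E x₀⁴ = 1/8` (the latter from the symmetries alone:
`E x₀² x₁² = E x₀⁴/3` by left translation by `(1+i)/√2`, and `E x₀² = E x₀⁴ + 3 E x₀² x₁²`).  Together:
`Var ≤ E(w − a)²` with `a = m'₀ κ`, `≤ (m₀'² + m₁'² + m₂'² + m₃'²) · 4 = 4|m_Δ|² = ∫ w² dσ`.

CONSEQUENCES (Parts C, D).  `oneLinkKRModulus_su2_var : R ≤ 1/4 → OneLinkKRModulus 2 R √(2/(1 − 2R))`
(the J-SC5 proof with the new variance bound); in Wilson units `oneLinkKRModulusSU2_var : β_W ≤ 1/6 →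
OneLinkKRModulusSU2 β_W (√(2/(1 − 3β_W))/4)`; the Dobrushin constant `18 β_W K₂ < 1 ⟸ 81 β_W² + 6 β_W < 2 ⟸
β_W ≤ 31/250` (`su2_window_var`); and, through the tree's three bridges, the `SU(2)`, `d = 4`
strong-coupling statements at every such `β_W` in the currencies SC-a (`su2_dlrMassGapAt_var/_124 :
DLRMassGapAt 4 2 (β_W/4)`), SC-b (`su2_strongCouplingFront_var/_124 : CrossoverLedger.StrongCouplingFront
(fundamentalLatticeRep 2) (β_W/2)`) and SC-c (`su2_latticeMassGap_var/_124/_ninth_var : CrossoverLedger.LatticeMassGap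
(fundamentalRep (Fin 2)) (β_W/2) (krRate (18 β_W K₂))`), hypothesis-free.  Numbers (two engines,
`ir/data/FRONT-SC-JSC8-window.txt`): window supremum `β_W = 0.1244037` (`g² ≥ 32.15`); at `β_W = 1/9` the Dobrushin
constant improves from `√(313/324) = 0.98288` to `√3/2 = 0.86603` and the rate `krRate` from `0.01727` to
`½ log(4/3) = 0.14384` (`su2_latticeMassGap_ninth_rate`); at `β_W = 0.12`: constant `0.95459`, rate `0.04647`; at
`β_W = 0.124`: constant `0.99579`, rate `0.00422`; at `1/12`: constant `0.61237`, rate `0.49041`.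

NOT CLAIMED.  Nothing at `β_W ≥ 0.12441`; no uniqueness beyond what `DLRMassGapAt` states; the device's ceiling
remains the Dobrushin row sum `18 β_W K₂` with `K₂ ≥ 1/4` (floor `β_W < 2/9`); Bałaban's papers [B1]–[B16] are not
used or cited anywhere in this file.
-/

open MeasureTheory Filter Topology ProbabilityTheory Finset Real
open scoped NNReal Quaternion
open Literature.Probability.LatticeModels
open Literature.MathematicalPhysics.QuantumLattice (fundamentalRep fundamentalLatticeRep quatMatrix su2Quat quatToSU2
  ymSpecification)

namespace Literature.MathematicalPhysics.QuantumFieldTheory.Balaban1983to89.StrongCouplingVarianceWindow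

open Literature.MathematicalPhysics.QuantumFieldTheory
open Literature.MathematicalPhysics.QuantumFieldTheory.Balaban1983to89.StrongCouplingDobrushinWindow
open Literature.MathematicalPhysics.QuantumFieldTheory.Balaban1983to89.StrongCouplingTorusWindow
open Literature.MathematicalPhysics.QuantumFieldTheory.Balaban1983to89.StrongCouplingKernelWindow
open Literature.MathematicalPhysics.QuantumFieldTheory.Balaban1983to89.StrongCouplingOpenWindow

noncomputable section

local notation "SU2" => Matrix.specialUnitaryGroup (Fin 2) ℂ
local notation "M₂" => Matrix (Fin 2) (Fin 2) ℂ
local notation "σ₂" => haarProbability (Matrix.specialUnitaryGroup (Fin 2) ℂ)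

/-! ## Part A: quaternion coordinates of `SU(2)` and the bi-invariance of Haar -/

section Quaternions

/-- The element of `SU(2)` with first row the unit quaternion `q` (`= quatMatrix q`).
[cite: Creutz2022, Ch. 8 (8.26)–(8.28)] -/
def unitSU2 (q : ℍ) (hq : ‖q‖ = 1) : SU2 :=
  ⟨quatMatrix q, QuantumLattice.quatMatrix_mem_specialUnitaryGroup hq⟩

/-- `su2Quat (unitSU2 q) = q`. [folklore] -/
@[simp] private theorem su2Quat_unitSU2 (q : ℍ) (hq : ‖q‖ = 1) : su2Quat (unitSU2 q hq) = q := by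
  ext <;> rfl

/-- A quaternion with `re² + imI² + imJ² + imK² = 1` has norm `1`. [folklore] -/
private theorem norm_eq_one_of_sq_sum {q : ℍ} (h : q.re ^ 2 + q.imI ^ 2 + q.imJ ^ 2 + q.imK ^ 2 = 1) : ‖q‖ = 1 := by
  have h1 : ‖q‖ * ‖q‖ = 1 := by
    rw [← Quaternion.normSq_eq_norm_mul_self, Quaternion.normSq_def']; exact h
  nlinarith [norm_nonneg q]

/-- The coordinates of `g ∈ SU(2)` lie on the unit sphere: `x₀² + x₁² + x₂² + x₃² = 1`.
[cite: Creutz2022, Ch. 8 (8.26)] -/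
theorem sq_sum_su2Quat (g : SU2) :
    (su2Quat g).re ^ 2 + (su2Quat g).imI ^ 2 + (su2Quat g).imJ ^ 2 + (su2Quat g).imK ^ 2 = 1 := by
  have h := QuantumLattice.normSq_su2Quat g
  rwa [Quaternion.normSq_def'] at h

/-- `|x₀| ≤ 1` for the real coordinate of `g ∈ SU(2)`. [folklore] -/
private theorem abs_re_su2Quat_le (g : SU2) : |(su2Quat g).re| ≤ 1 := by
  have h := sq_sum_su2Quat g
  rw [abs_le]
  constructor <;> nlinarith [sq_nonneg (su2Quat g).imI, sq_nonneg (su2Quat g).imJ, sq_nonneg (su2Quat g).imK]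

/-- **Bi-invariance of Haar in quaternion coordinates**: for unit quaternions `p, q` and every `Φ`,
`∫ Φ(p · x_g · q) dσ(g) = ∫ Φ(x_g) dσ(g)` (left translation by `unitSU2 p`, right translation by `unitSU2 q`).
[cite: Creutz2022, Ch. 8 (8.21)–(8.28)] -/
theorem integral_comp_units (Φ : ℍ → ℝ) {p q : ℍ} (hp : ‖p‖ = 1) (hq : ‖q‖ = 1) :
    ∫ g, Φ (p * su2Quat g * q) ∂σ₂ = ∫ g, Φ (su2Quat g) ∂σ₂ := by
  haveI := isMulLeftInvariant_haarProbability_su2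
  have h1 : ∀ g : SU2, p * su2Quat g * q = su2Quat (unitSU2 p hp * g * unitSU2 q hq) := fun g => by
    rw [su2Quat_mul, su2Quat_mul, su2Quat_unitSU2, su2Quat_unitSU2]
  simp_rw [h1]
  have h2 := integral_mul_right_eq_self (μ := σ₂) (fun g => Φ (su2Quat (unitSU2 p hp * g))) (unitSU2 q hq)
  have h3 := integral_mul_left_eq_self (μ := σ₂) (fun g => Φ (su2Quat g)) (unitSU2 p hp)
  simp only [mul_assoc] at h2 ⊢
  rw [h2, h3]

/-- Left translation only. [folklore] -/
private theorem integral_comp_unit_left (Φ : ℍ → ℝ) {p : ℍ} (hp : ‖p‖ = 1) :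
    ∫ g, Φ (p * su2Quat g) ∂σ₂ = ∫ g, Φ (su2Quat g) ∂σ₂ := by
  have h := integral_comp_units Φ hp norm_one
  simpa only [mul_one] using h

/-- Right translation only. [folklore] -/
private theorem integral_comp_unit_right (Φ : ℍ → ℝ) {q : ℍ} (hq : ‖q‖ = 1) :
    ∫ g, Φ (su2Quat g * q) ∂σ₂ = ∫ g, Φ (su2Quat g) ∂σ₂ := by
  have h := integral_comp_units Φ norm_one hq
  simpa only [one_mul] using h

/-! ### The unit quaternions `i`, `j`, `ω = (1+i+j+k)/2`, `(1+i)/√2` and their action on coordinates -/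

/-- `i`. [folklore] -/
def qI : ℍ := ⟨0, 1, 0, 0⟩
/-- `j`. [folklore] -/
def qJ : ℍ := ⟨0, 0, 1, 0⟩
/-- `k`. [folklore] -/
def qK : ℍ := ⟨0, 0, 0, 1⟩
/-- `ω = (1 + i + j + k)/2` (conjugation by `ω` permutes `i → j → k → i`). [folklore] -/
def qW : ℍ := ⟨1 / 2, 1 / 2, 1 / 2, 1 / 2⟩
/-- `(1 + i)/√2`. [folklore] -/
def qP : ℍ := ⟨Real.sqrt 2 / 2, Real.sqrt 2 / 2, 0, 0⟩

/-- `|i| = 1`. [folklore] -/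
private theorem norm_qI : ‖qI‖ = 1 := norm_eq_one_of_sq_sum (by simp [qI])
/-- `|j| = 1`. [folklore] -/
private theorem norm_qJ : ‖qJ‖ = 1 := norm_eq_one_of_sq_sum (by simp [qJ])
/-- `|ω| = 1`. [folklore] -/
private theorem norm_qW : ‖qW‖ = 1 := norm_eq_one_of_sq_sum (by simp [qW]; norm_num)
/-- `|(1+i)/√2| = 1`. [folklore] -/
private theorem norm_qP : ‖qP‖ = 1 :=
  norm_eq_one_of_sq_sum (by
    have h : Real.sqrt 2 ^ 2 = 2 := Real.sq_sqrt (by norm_num)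
    simp only [qP]
    nlinarith [h])

/-- Conjugation by `i`: `(x₀, x₁, x₂, x₃) ↦ (x₀, x₁, −x₂, −x₃)`. [folklore] -/
private theorem conj_qI (x : ℍ) : qI * x * star qI = ⟨x.re, x.imI, -x.imJ, -x.imK⟩ := by
  ext <;> simp only [qI, Quaternion.re_mul, Quaternion.imI_mul, Quaternion.imJ_mul, Quaternion.imK_mul, Quaternion.re_star, Quaternion.imI_star, Quaternion.imJ_star, Quaternion.imK_star] <;> ring

/-- Conjugation by `j`: `(x₀, x₁, x₂, x₃) ↦ (x₀, −x₁, x₂, −x₃)`. [folklore] -/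
private theorem conj_qJ (x : ℍ) : qJ * x * star qJ = ⟨x.re, -x.imI, x.imJ, -x.imK⟩ := by
  ext <;> simp only [qJ, Quaternion.re_mul, Quaternion.imI_mul, Quaternion.imJ_mul, Quaternion.imK_mul, Quaternion.re_star, Quaternion.imI_star, Quaternion.imJ_star, Quaternion.imK_star] <;> ring

/-- Conjugation by `k`: `(x₀, x₁, x₂, x₃) ↦ (x₀, −x₁, −x₂, x₃)`. [folklore] -/
private theorem conj_qK (x : ℍ) : qK * x * star qK = ⟨x.re, -x.imI, -x.imJ, x.imK⟩ := by
  ext <;> simp only [qK, Quaternion.re_mul, Quaternion.imI_mul, Quaternion.imJ_mul, Quaternion.imK_mul, Quaternion.re_star, Quaternion.imI_star, Quaternion.imJ_star, Quaternion.imK_star] <;> ring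

/-- `|k| = 1`. [folklore] -/
private theorem norm_qK : ‖qK‖ = 1 := norm_eq_one_of_sq_sum (by simp [qK])

/-- Conjugation by `ω`: `(x₀, x₁, x₂, x₃) ↦ (x₀, x₃, x₁, x₂)`. [folklore] -/
private theorem conj_qW (x : ℍ) : qW * x * star qW = ⟨x.re, x.imK, x.imI, x.imJ⟩ := by
  ext <;> simp only [qW, Quaternion.re_mul, Quaternion.imI_mul, Quaternion.imJ_mul, Quaternion.imK_mul, Quaternion.re_star, Quaternion.imI_star, Quaternion.imJ_star, Quaternion.imK_star] <;> ring

/-- Left translation by `i`: `(x₀, x₁, x₂, x₃) ↦ (−x₁, x₀, −x₃, x₂)`. [folklore] -/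
private theorem qI_mul (x : ℍ) : qI * x = ⟨-x.imI, x.re, -x.imK, x.imJ⟩ := by
  ext <;> simp only [qI, Quaternion.re_mul, Quaternion.imI_mul, Quaternion.imJ_mul, Quaternion.imK_mul] <;> ring

/-- Real part of left translation by `(1+i)/√2`: `(x₀ − x₁)/√2`. [folklore] -/
private theorem re_qP_mul (x : ℍ) : (qP * x).re = Real.sqrt 2 / 2 * (x.re - x.imI) := by
  simp only [qP, Quaternion.re_mul]; ring

/-- `su2Quat` as a linear combination of the constant quaternions `1, i, j, k`. [folklore] -/
private theorem su2Quat_eq_sum (g : SU2) :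
    su2Quat g = (su2Quat g).re • (1 : ℍ) + (su2Quat g).imI • qI + (su2Quat g).imJ • qJ +
      (su2Quat g).imK • qK := by
  ext <;> simp [qI, qJ, qK]

/-- `su2Quat : SU(2) → ℍ` is continuous. [folklore] -/
private theorem continuous_su2Quat : Continuous (su2Quat : SU2 → ℍ) := by
  have h00 : Continuous fun g : SU2 => (g : M₂) 0 0 :=
    (continuous_apply_apply 0 0).comp continuous_subtype_val
  have h01 : Continuous fun g : SU2 => (g : M₂) 0 1 :=
    (continuous_apply_apply 0 1).comp continuous_subtype_val
  have hre : Continuous fun g : SU2 => (su2Quat g).re := Complex.continuous_re.comp h00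
  have himI : Continuous fun g : SU2 => (su2Quat g).imI := Complex.continuous_im.comp h00
  have himJ : Continuous fun g : SU2 => (su2Quat g).imJ := Complex.continuous_re.comp h01
  have himK : Continuous fun g : SU2 => (su2Quat g).imK := Complex.continuous_im.comp h01
  have : Continuous fun g : SU2 => (su2Quat g).re • (1 : ℍ) + (su2Quat g).imI • qI + (su2Quat g).imJ • qJ +
      (su2Quat g).imK • qK :=
    (((hre.smul continuous_const).add (himI.smul continuous_const)).add (himJ.smul continuous_const)).add
      (himK.smul continuous_const)
  refine this.congr fun g => (su2Quat_eq_sum g).symm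

/-- Continuous functions of the coordinates are Haar integrable. [folklore] -/
private theorem integrable_comp_su2Quat {Φ : ℍ → ℝ} (hΦ : Continuous Φ) : Integrable (fun g : SU2 => Φ (su2Quat g)) σ₂ :=
  (hΦ.comp continuous_su2Quat).integrable_of_hasCompactSupport (HasCompactSupport.of_compactSpace _)

end Quaternions

/-! ## Part B.1: Haar moments of the real coordinate: `E x₀² = 1/4`, `E x₀⁴ = 1/8`, odd moments `0` -/

section Moments

/-- `su2Quat (−1) = −1`. [folklore] -/
private theorem su2Quat_elN : su2Quat elN = -1 := by
  ext <;> simp [elN, su2Quat, quatMatrix]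

/-- `x(−g) = −x(g)`. [folklore] -/
private theorem su2Quat_elN_mul (g : SU2) : su2Quat (elN * g) = -su2Quat g := by
  rw [su2Quat_mul, su2Quat_elN, neg_one_mul]

/-- **Odd moments vanish**: `∫ x₀^(2k+1) dσ = 0` (left translation by `−1`). [cite: Creutz2022, Ch. 8 (8.27)] -/
theorem integral_re_pow_odd (k : ℕ) : ∫ g, (su2Quat g).re ^ (2 * k + 1) ∂σ₂ = 0 :=
  integral_eq_zero_of_odd fun g => by
    rw [su2Quat_elN_mul, Quaternion.re_neg, neg_pow, Odd.neg_one_pow ⟨k, rfl⟩, neg_one_mul]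

/-- Powers of the coordinates are integrable. [folklore] -/
private theorem integrable_re_pow (k : ℕ) : Integrable (fun g : SU2 => (su2Quat g).re ^ k) σ₂ :=
  integrable_comp_su2Quat (Φ := fun x => x.re ^ k) ((Quaternion.continuous_re).pow k)

/-- **Second moment** `∫ x₀² dσ = 1/4` (the four coordinates are exchanged by left translation by `i` and
conjugation by `ω`, and their squares sum to `1`). [cite: Creutz2022, Ch. 8 (8.27)–(8.28)] -/
theorem integral_re_sq : ∫ g, (su2Quat g).re ^ 2 ∂σ₂ = 1 / 4 := by
  -- `E x₀² = E x₁²` (left translation by `i`)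
  have h01 : ∫ g, (su2Quat g).imI ^ 2 ∂σ₂ = ∫ g, (su2Quat g).re ^ 2 ∂σ₂ := by
    have h := integral_comp_unit_left (fun x : ℍ => x.re ^ 2) norm_qI
    simp only [qI_mul, neg_sq] at h
    simpa using h
  -- `E x₁² = E x₂² = E x₃²` (conjugation by `ω`)
  have h12 : ∫ g, (su2Quat g).imK ^ 2 ∂σ₂ = ∫ g, (su2Quat g).imI ^ 2 ∂σ₂ := by
    have h := integral_comp_units (fun x : ℍ => x.imI ^ 2) norm_qW (by rw [norm_star]; exact norm_qW)
    simpa only [conj_qW] using h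
  have h13 : ∫ g, (su2Quat g).imI ^ 2 ∂σ₂ = ∫ g, (su2Quat g).imJ ^ 2 ∂σ₂ := by
    have h := integral_comp_units (fun x : ℍ => x.imJ ^ 2) norm_qW (by rw [norm_star]; exact norm_qW)
    simpa only [conj_qW] using h
  -- the squares sum to one
  have hsum : ∫ g, ((su2Quat g).re ^ 2 + (su2Quat g).imI ^ 2 + (su2Quat g).imJ ^ 2 + (su2Quat g).imK ^ 2) ∂σ₂ = 1 := by
    simp_rw [sq_sum_su2Quat]; simp
  have i0 := integrable_re_pow 2
  have i1 : Integrable (fun g : SU2 => (su2Quat g).imI ^ 2) σ₂ :=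
    integrable_comp_su2Quat (Φ := fun x => x.imI ^ 2) ((Quaternion.continuous_imI).pow 2)
  have i2 : Integrable (fun g : SU2 => (su2Quat g).imJ ^ 2) σ₂ :=
    integrable_comp_su2Quat (Φ := fun x => x.imJ ^ 2) ((Quaternion.continuous_imJ).pow 2)
  have i3 : Integrable (fun g : SU2 => (su2Quat g).imK ^ 2) σ₂ :=
    integrable_comp_su2Quat (Φ := fun x => x.imK ^ 2) ((Quaternion.continuous_imK).pow 2)
  have j1 : Integrable (fun g : SU2 => (su2Quat g).re ^ 2 + (su2Quat g).imI ^ 2) σ₂ := i0.add i1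
  have j2 : Integrable (fun g : SU2 => (su2Quat g).re ^ 2 + (su2Quat g).imI ^ 2 + (su2Quat g).imJ ^ 2) σ₂ := j1.add i2
  rw [integral_add j2 i3, integral_add j1 i2, integral_add i0 i1] at hsum
  linarith

/-- **Fourth moment** `∫ x₀⁴ dσ = 1/8`: `E x₀² x₁² = E x₀⁴/3` (left translation by `(1+i)/√2`, whose real part is
`(x₀ − x₁)/√2`, with `E x₁⁴ = E x₀⁴` and `E x₀³x₁ = E x₀x₁³ = 0`), and `E x₀² = E x₀²(x₀²+x₁²+x₂²+x₃²) = E x₀⁴ + 3 E x₀²x₁²`.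
[cite: Creutz2022, Ch. 8 (8.27)–(8.28)] -/
theorem integral_re_pow_four : ∫ g, (su2Quat g).re ^ 4 ∂σ₂ = 1 / 8 := by
  have hst : ‖star qW‖ = 1 := by rw [norm_star]; exact norm_qW
  have hstJ : ‖star qJ‖ = 1 := by rw [norm_star]; exact norm_qJ
  -- notation-free shorthands for the mixed moments
  have i4 := integrable_re_pow 4
  have i22 : Integrable (fun g : SU2 => (su2Quat g).re ^ 2 * (su2Quat g).imI ^ 2) σ₂ :=
    integrable_comp_su2Quat (Φ := fun x => x.re ^ 2 * x.imI ^ 2)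
      (((Quaternion.continuous_re).pow 2).mul ((Quaternion.continuous_imI).pow 2))
  have i31 : Integrable (fun g : SU2 => (su2Quat g).re ^ 3 * (su2Quat g).imI) σ₂ :=
    integrable_comp_su2Quat (Φ := fun x => x.re ^ 3 * x.imI)
      (((Quaternion.continuous_re).pow 3).mul Quaternion.continuous_imI)
  have i13 : Integrable (fun g : SU2 => (su2Quat g).re * (su2Quat g).imI ^ 3) σ₂ :=
    integrable_comp_su2Quat (Φ := fun x => x.re * x.imI ^ 3)
      ((Quaternion.continuous_re).mul ((Quaternion.continuous_imI).pow 3))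
  have i04 : Integrable (fun g : SU2 => (su2Quat g).imI ^ 4) σ₂ :=
    integrable_comp_su2Quat (Φ := fun x => x.imI ^ 4) ((Quaternion.continuous_imI).pow 4)
  -- `E x₁⁴ = E x₀⁴`
  have h04 : ∫ g, (su2Quat g).imI ^ 4 ∂σ₂ = ∫ g, (su2Quat g).re ^ 4 ∂σ₂ := by
    have h := integral_comp_unit_left (fun x : ℍ => x.re ^ 4) norm_qI
    simp only [qI_mul] at h
    have he : ∀ g : SU2, (-(su2Quat g).imI) ^ 4 = (su2Quat g).imI ^ 4 := fun g => by ring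
    simp_rw [he] at h
    exact h
  -- the odd mixed moments vanish (conjugation by `j` flips `x₁`)
  have h31 : ∫ g, (su2Quat g).re ^ 3 * (su2Quat g).imI ∂σ₂ = 0 := by
    have h := integral_comp_units (fun x : ℍ => x.re ^ 3 * x.imI) norm_qJ hstJ
    simp only [conj_qJ, mul_neg] at h
    rw [integral_neg] at h
    linarith
  have h13 : ∫ g, (su2Quat g).re * (su2Quat g).imI ^ 3 ∂σ₂ = 0 := by
    have h := integral_comp_units (fun x : ℍ => x.re * x.imI ^ 3) norm_qJ hstJ
    simp only [conj_qJ] at h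
    have he : ∀ g : SU2, (su2Quat g).re * (-(su2Quat g).imI) ^ 3 = -((su2Quat g).re * (su2Quat g).imI ^ 3) :=
      fun g => by ring
    simp_rw [he] at h
    rw [integral_neg] at h
    linarith
  -- left translation by `(1+i)/√2`: `E x₀⁴ = E ((x₀ − x₁)/√2)⁴ = (2 E x₀⁴ + 6 E x₀²x₁²)/4`
  have h22 : ∫ g, (su2Quat g).re ^ 2 * (su2Quat g).imI ^ 2 ∂σ₂ = (∫ g, (su2Quat g).re ^ 4 ∂σ₂) / 3 := by
    have h := integral_comp_unit_left (fun x : ℍ => x.re ^ 4) norm_qP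
    simp only [re_qP_mul] at h
    have hs : (Real.sqrt 2 / 2) ^ 4 = 1 / 4 := by
      have h2 : Real.sqrt 2 ^ 2 = 2 := Real.sq_sqrt (by norm_num)
      nlinarith [h2]
    have he : ∀ g : SU2, (Real.sqrt 2 / 2 * ((su2Quat g).re - (su2Quat g).imI)) ^ 4 =
        (1 / 4) * (su2Quat g).re ^ 4 - (su2Quat g).re ^ 3 * (su2Quat g).imI +
          (3 / 2) * ((su2Quat g).re ^ 2 * (su2Quat g).imI ^ 2) - (su2Quat g).re * (su2Quat g).imI ^ 3 +
            (1 / 4) * (su2Quat g).imI ^ 4 := fun g => by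
      rw [mul_pow, hs]; ring
    simp_rw [he] at h
    have k1 : Integrable (fun g : SU2 => 1 / 4 * (su2Quat g).re ^ 4) σ₂ := i4.const_mul _
    have k2 : Integrable (fun g : SU2 => 1 / 4 * (su2Quat g).re ^ 4 - (su2Quat g).re ^ 3 * (su2Quat g).imI) σ₂ :=
      k1.sub i31
    have k3 : Integrable (fun g : SU2 => 1 / 4 * (su2Quat g).re ^ 4 - (su2Quat g).re ^ 3 * (su2Quat g).imI +
        3 / 2 * ((su2Quat g).re ^ 2 * (su2Quat g).imI ^ 2)) σ₂ := k2.add (i22.const_mul _)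
    have k4 : Integrable (fun g : SU2 => 1 / 4 * (su2Quat g).re ^ 4 - (su2Quat g).re ^ 3 * (su2Quat g).imI +
        3 / 2 * ((su2Quat g).re ^ 2 * (su2Quat g).imI ^ 2) - (su2Quat g).re * (su2Quat g).imI ^ 3) σ₂ := k3.sub i13
    have k5 : Integrable (fun g : SU2 => 1 / 4 * (su2Quat g).imI ^ 4) σ₂ := i04.const_mul _
    have k6 : Integrable (fun g : SU2 => 3 / 2 * ((su2Quat g).re ^ 2 * (su2Quat g).imI ^ 2)) σ₂ := i22.const_mul _
    rw [integral_add k4 k5, integral_sub k3 i13, integral_add k2 k6, integral_sub k1 i31, integral_const_mul,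
      integral_const_mul, integral_const_mul, h31, h13, h04] at h
    linarith
  -- `E x₀² x₂² = E x₀² x₃² = E x₀² x₁²` (conjugation by `ω` fixes `x₀` and cycles `x₁, x₂, x₃`)
  have h2J : ∫ g, (su2Quat g).re ^ 2 * (su2Quat g).imJ ^ 2 ∂σ₂ = ∫ g, (su2Quat g).re ^ 2 * (su2Quat g).imI ^ 2 ∂σ₂ := by
    have h := integral_comp_units (fun x : ℍ => x.re ^ 2 * x.imJ ^ 2) norm_qW hst
    simp only [conj_qW] at h
    exact h.symm
  have h2K : ∫ g, (su2Quat g).re ^ 2 * (su2Quat g).imK ^ 2 ∂σ₂ = ∫ g, (su2Quat g).re ^ 2 * (su2Quat g).imI ^ 2 ∂σ₂ := by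
    have h := integral_comp_units (fun x : ℍ => x.re ^ 2 * x.imI ^ 2) norm_qW hst
    simp only [conj_qW] at h
    exact h
  -- `E x₀² = E x₀² (x₀² + x₁² + x₂² + x₃²)`
  have hsplit : ∫ g, (su2Quat g).re ^ 2 ∂σ₂ = ∫ g, ((su2Quat g).re ^ 4 + (su2Quat g).re ^ 2 * (su2Quat g).imI ^ 2 +
      (su2Quat g).re ^ 2 * (su2Quat g).imJ ^ 2 + (su2Quat g).re ^ 2 * (su2Quat g).imK ^ 2) ∂σ₂ := by
    refine integral_congr_ae (ae_of_all _ fun g => ?_)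
    have h1 := sq_sum_su2Quat g
    simp only
    linear_combination (-(su2Quat g).re ^ 2) * h1
  have i2J : Integrable (fun g : SU2 => (su2Quat g).re ^ 2 * (su2Quat g).imJ ^ 2) σ₂ :=
    integrable_comp_su2Quat (Φ := fun x => x.re ^ 2 * x.imJ ^ 2)
      (((Quaternion.continuous_re).pow 2).mul ((Quaternion.continuous_imJ).pow 2))
  have i2K : Integrable (fun g : SU2 => (su2Quat g).re ^ 2 * (su2Quat g).imK ^ 2) σ₂ :=
    integrable_comp_su2Quat (Φ := fun x => x.re ^ 2 * x.imK ^ 2)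
      (((Quaternion.continuous_re).pow 2).mul ((Quaternion.continuous_imK).pow 2))
  have l1 : Integrable (fun g : SU2 => (su2Quat g).re ^ 4 + (su2Quat g).re ^ 2 * (su2Quat g).imI ^ 2) σ₂ := i4.add i22
  have l2 : Integrable (fun g : SU2 => (su2Quat g).re ^ 4 + (su2Quat g).re ^ 2 * (su2Quat g).imI ^ 2 +
      (su2Quat g).re ^ 2 * (su2Quat g).imJ ^ 2) σ₂ := l1.add i2J
  rw [integral_re_sq, integral_add l2 i2K, integral_add l1 i2J, integral_add i4 i22, h2J, h2K, h22] at hsplit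
  linarith

/-- **Integral of a quintic in `x₀`**: `∫ (a₀ + a₁x₀ + a₂x₀² + a₃x₀³ + a₄x₀⁴ + a₅x₀⁵) dσ = a₀ + a₂/4 + a₄/8`.
[cite: Creutz2022, Ch. 8 (8.27)–(8.28)] -/
theorem integral_re_quintic (a₀ a₁ a₂ a₃ a₄ a₅ : ℝ) :
    ∫ g, (a₀ + a₁ * (su2Quat g).re + a₂ * (su2Quat g).re ^ 2 + a₃ * (su2Quat g).re ^ 3 +
        a₄ * (su2Quat g).re ^ 4 + a₅ * (su2Quat g).re ^ 5) ∂σ₂ = a₀ + a₂ / 4 + a₄ / 8 := by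
  have i1 : Integrable (fun g : SU2 => a₁ * (su2Quat g).re) σ₂ := by
    have := (integrable_re_pow 1).const_mul a₁
    simpa using this
  have i2 := (integrable_re_pow 2).const_mul a₂
  have i3 := (integrable_re_pow 3).const_mul a₃
  have i4 := (integrable_re_pow 4).const_mul a₄
  have i5 := (integrable_re_pow 5).const_mul a₅
  have i0 : Integrable (fun _ : SU2 => a₀) σ₂ := integrable_const _
  have m1 : ∫ g, (su2Quat g).re ∂σ₂ = 0 := by simpa using integral_re_pow_odd 0
  have m3 : ∫ g, (su2Quat g).re ^ 3 ∂σ₂ = 0 := by simpa using integral_re_pow_odd 1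
  have m5 : ∫ g, (su2Quat g).re ^ 5 ∂σ₂ = 0 := by simpa using integral_re_pow_odd 2
  have j1 : Integrable (fun g : SU2 => a₀ + a₁ * (su2Quat g).re) σ₂ := i0.add i1
  have j2 : Integrable (fun g : SU2 => a₀ + a₁ * (su2Quat g).re + a₂ * (su2Quat g).re ^ 2) σ₂ := j1.add i2
  have j3 : Integrable (fun g : SU2 => a₀ + a₁ * (su2Quat g).re + a₂ * (su2Quat g).re ^ 2 +
      a₃ * (su2Quat g).re ^ 3) σ₂ := j2.add i3
  have j4 : Integrable (fun g : SU2 => a₀ + a₁ * (su2Quat g).re + a₂ * (su2Quat g).re ^ 2 +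
      a₃ * (su2Quat g).re ^ 3 + a₄ * (su2Quat g).re ^ 4) σ₂ := j3.add i4
  rw [integral_add j4 i5, integral_add j3 i4, integral_add j2 i3, integral_add j1 i2, integral_add i0 i1,
    integral_const_mul, integral_const_mul, integral_const_mul, integral_const_mul, integral_const_mul, m1, m3, m5,
    integral_re_sq, integral_re_pow_four]
  simp only [integral_const, smul_eq_mul, Measure.real, measure_univ, ENNReal.toReal_one]
  ring

end Moments

/-! ## Part B.2: the two one-dimensional inequalities for the marginal of `x₀` under the weight `e^{κ x₀}` -/

section OneDimensional

/-- Fourth-order Taylor bound with a bounded prefactor: for `|s| ≤ 1` and `|φ| ≤ C`,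
`|φ e^s − φ (1 + s + s²/2 + s³/6)| ≤ C · (5/96) s⁴` (Mathlib's `Real.exp_bound`). [folklore] -/
private theorem abs_mul_exp_sub_taylor_le {s φ C : ℝ} (hs : |s| ≤ 1) (hφ : |φ| ≤ C) :
    |φ * exp s - φ * (1 + s + s ^ 2 / 2 + s ^ 3 / 6)| ≤ C * (5 / 96 * s ^ 4) := by
  have hb := Real.exp_bound hs (n := 4) (by norm_num)
  have hsum : ∑ m ∈ range 4, s ^ m / (m.factorial : ℝ) = 1 + s + s ^ 2 / 2 + s ^ 3 / 6 := by
    simp [Finset.sum_range_succ, Nat.factorial]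
  rw [hsum] at hb
  have hb' : |exp s - (1 + s + s ^ 2 / 2 + s ^ 3 / 6)| ≤ 5 / 96 * s ^ 4 := by
    refine hb.trans (le_of_eq ?_)
    rw [pow_abs, abs_of_nonneg (by positivity : (0 : ℝ) ≤ s ^ 4)]
    norm_num [Nat.factorial]
    ring
  rw [← mul_sub, abs_mul]
  exact mul_le_mul hφ hb' (abs_nonneg _) ((abs_nonneg _).trans hφ)

/-- Quintics in `x₀` are integrable. [folklore] -/
private theorem integrable_re_quintic (a₀ a₁ a₂ a₃ a₄ a₅ : ℝ) :
    Integrable (fun g : SU2 => a₀ + a₁ * (su2Quat g).re + a₂ * (su2Quat g).re ^ 2 + a₃ * (su2Quat g).re ^ 3 +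
        a₄ * (su2Quat g).re ^ 4 + a₅ * (su2Quat g).re ^ 5) σ₂ := by
  have i1 : Integrable (fun g : SU2 => a₁ * (su2Quat g).re) σ₂ := by
    have := (integrable_re_pow 1).const_mul a₁
    simpa using this
  exact (((((integrable_const a₀).add i1).add ((integrable_re_pow 2).const_mul a₂)).add
    ((integrable_re_pow 3).const_mul a₃)).add ((integrable_re_pow 4).const_mul a₄)).add
      ((integrable_re_pow 5).const_mul a₅)

/-- The weighted monomials `x₀^k e^{κ x₀}` are integrable. [folklore] -/
private theorem integrable_re_pow_mul_exp (κ : ℝ) (k : ℕ) :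
    Integrable (fun g : SU2 => (su2Quat g).re ^ k * exp (κ * (su2Quat g).re)) σ₂ :=
  integrable_comp_su2Quat (Φ := fun x => x.re ^ k * exp (κ * x.re))
    (((Quaternion.continuous_re).pow k).mul (continuous_exp.comp (continuous_const.mul Quaternion.continuous_re)))

/-- The weight `e^{κ x₀}` is integrable. [folklore] -/
private theorem integrable_exp_re (κ : ℝ) : Integrable (fun g : SU2 => exp (κ * (su2Quat g).re)) σ₂ := by
  simpa using integrable_re_pow_mul_exp κ 0

/-- `|κ x₀| ≤ 1` for `0 ≤ κ ≤ 1`. [folklore] -/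
private theorem abs_mul_re_le {κ : ℝ} (hκ0 : 0 ≤ κ) (hκ1 : κ ≤ 1) (g : SU2) : |κ * (su2Quat g).re| ≤ 1 := by
  rw [abs_mul, abs_of_nonneg hκ0]
  calc κ * |(su2Quat g).re| ≤ 1 * 1 := mul_le_mul hκ1 (abs_re_su2Quat_le g) (abs_nonneg _) zero_le_one
    _ = 1 := one_mul _

/-- **The tilted second moment of `x₀` is at least the Haar one**: for `0 ≤ κ ≤ 1`,
`(1/4) ∫ e^{κx₀} dσ ≤ ∫ x₀² e^{κx₀} dσ`.  Fourth-order Taylor with the exact moments: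
`∫ (x₀² − 1/4) e^{κx₀} dσ ≥ κ²/32 − 15κ⁴/3072 ≥ 0`.  (An instance of the Ellis–Monroe–Newman monotonicity for the
even single-site law `(1 − t²)^{1/2} dt`, proved here directly.) [cite: EllisMonroeNewman1976, Thm. 1.1 with Thm. 1.2(d)] -/
theorem quarter_integral_exp_le {κ : ℝ} (hκ0 : 0 ≤ κ) (hκ1 : κ ≤ 1) :
    (1 / 4) * ∫ g, exp (κ * (su2Quat g).re) ∂σ₂ ≤ ∫ g, (su2Quat g).re ^ 2 * exp (κ * (su2Quat g).re) ∂σ₂ := by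
  -- pointwise quintic minorant of `(x₀² − 1/4) e^{κ x₀}`
  have hpt : ∀ g : SU2,
      -1 / 4 + (-κ / 4) * (su2Quat g).re + (1 - κ ^ 2 / 8) * (su2Quat g).re ^ 2 + (κ - κ ^ 3 / 24) * (su2Quat g).re ^ 3 +
          (κ ^ 2 / 2 - 15 / 384 * κ ^ 4) * (su2Quat g).re ^ 4 + (κ ^ 3 / 6) * (su2Quat g).re ^ 5 ≤
        (su2Quat g).re ^ 2 * exp (κ * (su2Quat g).re) - (1 / 4) * exp (κ * (su2Quat g).re) := by
    intro g
    have ht := abs_re_su2Quat_le g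
    have hφ : |(su2Quat g).re ^ 2 - 1 / 4| ≤ 3 / 4 := by
      have h1 : (su2Quat g).re ^ 2 ≤ 1 := by
        have := abs_le.1 ht
        nlinarith
      rw [abs_le]
      constructor <;> nlinarith [sq_nonneg (su2Quat g).re]
    have hT := (abs_le.1 (abs_mul_exp_sub_taylor_le (abs_mul_re_le hκ0 hκ1 g) hφ)).1
    nlinarith [hT]
  have hval := integral_re_quintic (-1 / 4) (-κ / 4) (1 - κ ^ 2 / 8) (κ - κ ^ 3 / 24) (κ ^ 2 / 2 - 15 / 384 * κ ^ 4)
    (κ ^ 3 / 6)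
  have iP := integrable_re_quintic (-1 / 4) (-κ / 4) (1 - κ ^ 2 / 8) (κ - κ ^ 3 / 24) (κ ^ 2 / 2 - 15 / 384 * κ ^ 4)
    (κ ^ 3 / 6)
  have i2 := integrable_re_pow_mul_exp κ 2
  have i0 : Integrable (fun g : SU2 => (1 / 4) * exp (κ * (su2Quat g).re)) σ₂ := (integrable_exp_re κ).const_mul _
  have iD : Integrable (fun g : SU2 => (su2Quat g).re ^ 2 * exp (κ * (su2Quat g).re) -
      (1 / 4) * exp (κ * (su2Quat g).re)) σ₂ := i2.sub i0
  have hm := integral_mono iP iD fun g => hpt g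
  rw [integral_sub i2 i0, integral_const_mul, hval] at hm
  have hκ2 : κ ^ 2 ≤ 1 := by nlinarith
  nlinarith [sq_nonneg κ, hκ2]

/-- **The tilted second moment of `x₀` about `κ/4` is at most the Haar variance**: for `0 ≤ κ ≤ 1`,
`∫ (x₀ − κ/4)² e^{κx₀} dσ ≤ (1/4) ∫ e^{κx₀} dσ` (hence `Var_κ(x₀) ≤ 1/4 = Var_0(x₀)`).  Fourth-order Taylor with the
exact moments: `∫ ((x₀ − κ/4)² − 1/4) e^{κx₀} dσ ≤ −κ²/32 + 73κ⁴/12288 ≤ 0`.  (The GHS/Ellis–Monroe–Newman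
monotonicity of the variance of an even ferromagnetic single-site law in the external field, for the law
`(1 − t²)^{1/2} dt` whose `g'/g = −t/(1−t²)` is concave on `[0,1)`; proved here directly.)
[cite: EllisMonroeNewman1976, Thm. 1.1 with Thm. 1.2(d)] -/
theorem integral_shift_sq_mul_exp_le {κ : ℝ} (hκ0 : 0 ≤ κ) (hκ1 : κ ≤ 1) :
    ∫ g, ((su2Quat g).re - κ / 4) ^ 2 * exp (κ * (su2Quat g).re) ∂σ₂ ≤ (1 / 4) * ∫ g, exp (κ * (su2Quat g).re) ∂σ₂ := by
  -- pointwise quintic majorant of `((x₀ − κ/4)² − 1/4) e^{κ x₀}`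
  have hpt : ∀ g : SU2,
      ((su2Quat g).re - κ / 4) ^ 2 * exp (κ * (su2Quat g).re) - (1 / 4) * exp (κ * (su2Quat g).re) ≤
        (-1 / 4 + κ ^ 2 / 16) + (-3 * κ / 4 + κ ^ 3 / 16) * (su2Quat g).re +
          (1 - 5 * κ ^ 2 / 8 + κ ^ 4 / 32) * (su2Quat g).re ^ 2 + (κ - 7 * κ ^ 3 / 24 + κ ^ 5 / 96) * (su2Quat g).re ^ 3 +
            (κ ^ 2 / 2 - κ ^ 4 / 12 + 105 / 1536 * κ ^ 4) * (su2Quat g).re ^ 4 + (κ ^ 3 / 6) * (su2Quat g).re ^ 5 := by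
    intro g
    have ht := abs_re_su2Quat_le g
    have hψ : |((su2Quat g).re - κ / 4) ^ 2 - 1 / 4| ≤ 21 / 16 := by
      obtain ⟨h1, h2⟩ := abs_le.1 ht
      rw [abs_le]
      constructor <;> nlinarith [sq_nonneg ((su2Quat g).re - κ / 4)]
    have hT := (abs_le.1 (abs_mul_exp_sub_taylor_le (abs_mul_re_le hκ0 hκ1 g) hψ)).2
    nlinarith [hT]
  have hval := integral_re_quintic (-1 / 4 + κ ^ 2 / 16) (-3 * κ / 4 + κ ^ 3 / 16) (1 - 5 * κ ^ 2 / 8 + κ ^ 4 / 32)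
    (κ - 7 * κ ^ 3 / 24 + κ ^ 5 / 96) (κ ^ 2 / 2 - κ ^ 4 / 12 + 105 / 1536 * κ ^ 4) (κ ^ 3 / 6)
  have iP := integrable_re_quintic (-1 / 4 + κ ^ 2 / 16) (-3 * κ / 4 + κ ^ 3 / 16) (1 - 5 * κ ^ 2 / 8 + κ ^ 4 / 32)
    (κ - 7 * κ ^ 3 / 24 + κ ^ 5 / 96) (κ ^ 2 / 2 - κ ^ 4 / 12 + 105 / 1536 * κ ^ 4) (κ ^ 3 / 6)
  have iL : Integrable (fun g : SU2 => ((su2Quat g).re - κ / 4) ^ 2 * exp (κ * (su2Quat g).re)) σ₂ :=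
    integrable_comp_su2Quat (Φ := fun x => (x.re - κ / 4) ^ 2 * exp (κ * x.re))
      (((Quaternion.continuous_re.sub continuous_const).pow 2).mul
        (continuous_exp.comp (continuous_const.mul Quaternion.continuous_re)))
  have i0 : Integrable (fun g : SU2 => (1 / 4) * exp (κ * (su2Quat g).re)) σ₂ := (integrable_exp_re κ).const_mul _
  have iD : Integrable (fun g : SU2 => ((su2Quat g).re - κ / 4) ^ 2 * exp (κ * (su2Quat g).re) -
      (1 / 4) * exp (κ * (su2Quat g).re)) σ₂ := iL.sub i0
  have hm := integral_mono iD iP fun g => hpt g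
  rw [integral_sub iL i0, integral_const_mul, hval] at hm
  have hκ2 : κ ^ 2 ≤ 1 := by nlinarith
  nlinarith [sq_nonneg κ, hκ2, sq_nonneg (κ ^ 2)]

end OneDimensional

/-! ## Part B.3: the axis-form variance inequality under the weight `e^{κ x₀}` -/

section Core

/-- **Isotropy + the two one-dimensional inequalities**: for `0 ≤ κ ≤ 1` and every quaternion `m`,
`∫ (Re(x·m) − m₀ κ/4)² e^{κx₀} dσ ≤ (|m|²/4) ∫ e^{κx₀} dσ`.  The cross moments vanish (average over the
conjugations by `i, j, k`, which flip the signs of two of `x₁, x₂, x₃`), `∫ x₁² e = ∫ x₂² e = ∫ x₃² e = (1/3)∫(1 − x₀²) e`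
(conjugation by `ω`), and Part B.2 bounds the two remaining one-dimensional integrals.
[cite: Creutz2022, Ch. 18 (18.17)–(18.20)] -/
theorem integral_sq_sub_mul_exp_le {κ : ℝ} (hκ0 : 0 ≤ κ) (hκ1 : κ ≤ 1) (m : ℍ) :
    ∫ g, ((su2Quat g * m).re - m.re * κ / 4) ^ 2 * exp (κ * (su2Quat g).re) ∂σ₂ ≤
      Quaternion.normSq m / 4 * ∫ g, exp (κ * (su2Quat g).re) ∂σ₂ := by
  have hexpc : Continuous fun x : ℍ => exp (κ * x.re) := continuous_exp.comp (continuous_const.mul Quaternion.continuous_re)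
  -- the integrand as a function on `ℍ`, and its continuity
  set ℓ : ℍ → ℝ := fun x => ((x * m).re - m.re * κ / 4) ^ 2 * exp (κ * x.re) with hℓ
  have hℓc : Continuous ℓ :=
    (((Quaternion.continuous_re.comp (continuous_id.mul continuous_const)).sub continuous_const).pow 2).mul hexpc
  have hconjc : ∀ p q : ℍ, Continuous fun x : ℍ => p * x * q := fun p q =>
    (continuous_const.mul continuous_id).mul continuous_const
  -- the symmetrised integrand: cross terms cancel
  have hsym : ∀ x : ℍ, ℓ x + ℓ (qI * x * star qI) + ℓ (qJ * x * star qJ) + ℓ (qK * x * star qK) =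
      4 * (m.re ^ 2 * ((x.re - κ / 4) ^ 2 * exp (κ * x.re))) + 4 * (m.imI ^ 2 * (x.imI ^ 2 * exp (κ * x.re))) +
        4 * (m.imJ ^ 2 * (x.imJ ^ 2 * exp (κ * x.re))) + 4 * (m.imK ^ 2 * (x.imK ^ 2 * exp (κ * x.re))) := by
    intro x
    simp only [hℓ, conj_qI, conj_qJ, conj_qK, Quaternion.re_mul]
    ring
  have hstI : ‖star qI‖ = 1 := by rw [norm_star]; exact norm_qI
  have hstJ : ‖star qJ‖ = 1 := by rw [norm_star]; exact norm_qJ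
  have hstK : ‖star qK‖ = 1 := by rw [norm_star]; exact norm_qK
  have hstW : ‖star qW‖ = 1 := by rw [norm_star]; exact norm_qW
  have hI := integral_comp_units ℓ norm_qI hstI
  have hJ := integral_comp_units ℓ norm_qJ hstJ
  have hK := integral_comp_units ℓ norm_qK hstK
  have iℓ : Integrable (fun g : SU2 => ℓ (su2Quat g)) σ₂ := integrable_comp_su2Quat hℓc
  have iℓI : Integrable (fun g : SU2 => ℓ (qI * su2Quat g * star qI)) σ₂ :=
    integrable_comp_su2Quat (Φ := fun x => ℓ (qI * x * star qI)) (hℓc.comp (hconjc _ _))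
  have iℓJ : Integrable (fun g : SU2 => ℓ (qJ * su2Quat g * star qJ)) σ₂ :=
    integrable_comp_su2Quat (Φ := fun x => ℓ (qJ * x * star qJ)) (hℓc.comp (hconjc _ _))
  have iℓK : Integrable (fun g : SU2 => ℓ (qK * su2Quat g * star qK)) σ₂ :=
    integrable_comp_su2Quat (Φ := fun x => ℓ (qK * x * star qK)) (hℓc.comp (hconjc _ _))
  -- the four even moments
  have iA : Integrable (fun g : SU2 => ((su2Quat g).re - κ / 4) ^ 2 * exp (κ * (su2Quat g).re)) σ₂ :=
    integrable_comp_su2Quat (Φ := fun x => (x.re - κ / 4) ^ 2 * exp (κ * x.re))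
      (((Quaternion.continuous_re.sub continuous_const).pow 2).mul hexpc)
  have iV1 : Integrable (fun g : SU2 => (su2Quat g).imI ^ 2 * exp (κ * (su2Quat g).re)) σ₂ :=
    integrable_comp_su2Quat (Φ := fun x => x.imI ^ 2 * exp (κ * x.re)) ((Quaternion.continuous_imI.pow 2).mul hexpc)
  have iV2 : Integrable (fun g : SU2 => (su2Quat g).imJ ^ 2 * exp (κ * (su2Quat g).re)) σ₂ :=
    integrable_comp_su2Quat (Φ := fun x => x.imJ ^ 2 * exp (κ * x.re)) ((Quaternion.continuous_imJ.pow 2).mul hexpc)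
  have iV3 : Integrable (fun g : SU2 => (su2Quat g).imK ^ 2 * exp (κ * (su2Quat g).re)) σ₂ :=
    integrable_comp_su2Quat (Φ := fun x => x.imK ^ 2 * exp (κ * x.re)) ((Quaternion.continuous_imK.pow 2).mul hexpc)
  set Z : ℝ := ∫ g, exp (κ * (su2Quat g).re) ∂σ₂ with hZ
  set A : ℝ := ∫ g, ((su2Quat g).re - κ / 4) ^ 2 * exp (κ * (su2Quat g).re) ∂σ₂ with hA
  set U : ℝ := ∫ g, (su2Quat g).re ^ 2 * exp (κ * (su2Quat g).re) ∂σ₂ with hU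
  set V1 : ℝ := ∫ g, (su2Quat g).imI ^ 2 * exp (κ * (su2Quat g).re) ∂σ₂ with hV1
  set V2 : ℝ := ∫ g, (su2Quat g).imJ ^ 2 * exp (κ * (su2Quat g).re) ∂σ₂ with hV2
  set V3 : ℝ := ∫ g, (su2Quat g).imK ^ 2 * exp (κ * (su2Quat g).re) ∂σ₂ with hV3
  -- `4 ∫ ℓ = 4 (m₀² A + m₁² V1 + m₂² V2 + m₃² V3)`
  have h4 : 4 * ∫ g, ℓ (su2Quat g) ∂σ₂ = 4 * (m.re ^ 2 * A) + 4 * (m.imI ^ 2 * V1) + 4 * (m.imJ ^ 2 * V2) +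
      4 * (m.imK ^ 2 * V3) := by
    have j1 : Integrable (fun g : SU2 => ℓ (su2Quat g) + ℓ (qI * su2Quat g * star qI)) σ₂ := iℓ.add iℓI
    have j2 : Integrable (fun g : SU2 => ℓ (su2Quat g) + ℓ (qI * su2Quat g * star qI) + ℓ (qJ * su2Quat g * star qJ)) σ₂ :=
      j1.add iℓJ
    have hs : ∫ g, (ℓ (su2Quat g) + ℓ (qI * su2Quat g * star qI) + ℓ (qJ * su2Quat g * star qJ) +
        ℓ (qK * su2Quat g * star qK)) ∂σ₂ = 4 * ∫ g, ℓ (su2Quat g) ∂σ₂ := by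
      rw [integral_add j2 iℓK, integral_add j1 iℓJ, integral_add iℓ iℓI, hI, hJ, hK]
      ring
    rw [← hs]
    simp_rw [hsym]
    have k1 : Integrable (fun g : SU2 => 4 * (m.re ^ 2 * (((su2Quat g).re - κ / 4) ^ 2 * exp (κ * (su2Quat g).re)))) σ₂ :=
      (iA.const_mul _).const_mul _
    have k2 : Integrable (fun g : SU2 => 4 * (m.imI ^ 2 * ((su2Quat g).imI ^ 2 * exp (κ * (su2Quat g).re)))) σ₂ :=
      (iV1.const_mul _).const_mul _
    have k3 : Integrable (fun g : SU2 => 4 * (m.imJ ^ 2 * ((su2Quat g).imJ ^ 2 * exp (κ * (su2Quat g).re)))) σ₂ :=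
      (iV2.const_mul _).const_mul _
    have k4 : Integrable (fun g : SU2 => 4 * (m.imK ^ 2 * ((su2Quat g).imK ^ 2 * exp (κ * (su2Quat g).re)))) σ₂ :=
      (iV3.const_mul _).const_mul _
    have l1 : Integrable (fun g : SU2 => 4 * (m.re ^ 2 * (((su2Quat g).re - κ / 4) ^ 2 * exp (κ * (su2Quat g).re))) +
        4 * (m.imI ^ 2 * ((su2Quat g).imI ^ 2 * exp (κ * (su2Quat g).re)))) σ₂ := k1.add k2
    have l2 : Integrable (fun g : SU2 => 4 * (m.re ^ 2 * (((su2Quat g).re - κ / 4) ^ 2 * exp (κ * (su2Quat g).re))) +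
        4 * (m.imI ^ 2 * ((su2Quat g).imI ^ 2 * exp (κ * (su2Quat g).re))) +
        4 * (m.imJ ^ 2 * ((su2Quat g).imJ ^ 2 * exp (κ * (su2Quat g).re)))) σ₂ := l1.add k3
    rw [integral_add l2 k4, integral_add l1 k3, integral_add k1 k2, integral_const_mul, integral_const_mul,
      integral_const_mul, integral_const_mul, integral_const_mul, integral_const_mul, integral_const_mul,
      integral_const_mul]
  -- isotropy: `V2 = V1`, `V3 = V1`
  have eV2 : V1 = V2 := by
    have h := integral_comp_units (fun x : ℍ => x.imJ ^ 2 * exp (κ * x.re)) norm_qW hstW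
    simp only [conj_qW] at h
    exact h
  have eV3 : V3 = V1 := by
    have h := integral_comp_units (fun x : ℍ => x.imI ^ 2 * exp (κ * x.re)) norm_qW hstW
    simp only [conj_qW] at h
    exact h
  -- the sphere: `U + V1 + V2 + V3 = Z`
  have hsphere : U + V1 + V2 + V3 = Z := by
    have m1 : Integrable (fun g : SU2 => (su2Quat g).re ^ 2 * exp (κ * (su2Quat g).re) +
        (su2Quat g).imI ^ 2 * exp (κ * (su2Quat g).re)) σ₂ := (integrable_re_pow_mul_exp κ 2).add iV1
    have m2 : Integrable (fun g : SU2 => (su2Quat g).re ^ 2 * exp (κ * (su2Quat g).re) +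
        (su2Quat g).imI ^ 2 * exp (κ * (su2Quat g).re) + (su2Quat g).imJ ^ 2 * exp (κ * (su2Quat g).re)) σ₂ := m1.add iV2
    rw [hU, hV1, hV2, hV3, hZ, ← integral_add (integrable_re_pow_mul_exp κ 2) iV1, ← integral_add m1 iV2,
      ← integral_add m2 iV3]
    refine integral_congr_ae (ae_of_all _ fun g => ?_)
    have h1 := sq_sum_su2Quat g
    simp only
    linear_combination exp (κ * (su2Quat g).re) * h1
  -- the two one-dimensional inequalities
  have hAle : A ≤ 1 / 4 * Z := integral_shift_sq_mul_exp_le hκ0 hκ1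
  have hUge : 1 / 4 * Z ≤ U := quarter_integral_exp_le hκ0 hκ1
  have hZ0 : 0 ≤ Z := integral_nonneg fun g => (exp_pos _).le
  -- assemble
  have hV1le : V1 ≤ Z / 4 := by linarith
  have hnormSq : Quaternion.normSq m = m.re ^ 2 + m.imI ^ 2 + m.imJ ^ 2 + m.imK ^ 2 := Quaternion.normSq_def' m
  show ∫ g, ℓ (su2Quat g) ∂σ₂ ≤ Quaternion.normSq m / 4 * Z
  rw [hnormSq]
  nlinarith [sq_nonneg m.re, sq_nonneg m.imI, sq_nonneg m.imJ, sq_nonneg m.imK, eV2, eV3]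

end Core

/-! ## Part B.4: the variance of a linear observable under the one-link tilt is at most its Haar variance -/

section Variance

/-- The quaternionic part of a `2 × 2` complex matrix: `Re tr(g M) = 2 Re(x_g · qp M)`. [folklore] -/
def qp (M : M₂) : ℍ :=
  ⟨(((M 0 0).re + (M 1 1).re) / 2), (((M 0 0).im - (M 1 1).im) / 2), (((M 0 1).re - (M 1 0).re) / 2),
    (((M 1 0).im + (M 0 1).im) / 2)⟩

/-- **`Re tr(g M)` is the linear form `2 Re(x_g · qp M)` of the unit quaternion of `g`.** [cite: Creutz2022, Ch. 18 (18.13)–(18.15)] -/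
theorem re_trace_eq_two_mul_re (g : SU2) (M : M₂) : ((g : M₂) * M).trace.re = 2 * (su2Quat g * qp M).re := by
  rw [re_trace_su2_mul]
  simp only [qp, su2Quat, Quaternion.re_mul]
  ring

/-- The Haar second moment in quaternion form: `∫ (2 Re tr(g Δ))² dσ = 4 |qp Δ|²`. [cite: Creutz2022, Ch. 8 (8.27)–(8.28)] -/
theorem integral_sq_two_mul_re_trace (Δ : M₂) :
    ∫ g, ((2 : ℝ) * (((g : M₂) * Δ).trace.re)) ^ 2 ∂σ₂ = 4 * Quaternion.normSq (qp Δ) := by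
  have h2 : ∀ g : SU2, ((2 : ℝ) * (((g : M₂) * Δ).trace.re)) ^ 2 = 4 * (((g : M₂) * Δ).trace.re) ^ 2 := fun g => by ring
  simp_rw [h2]
  rw [integral_const_mul, integral_sq_re_trace_su2_mul, Quaternion.normSq_def']
  simp only [qp]
  ring

/-- A unit quaternion rotating `m` onto the positive real axis: `‖y‖ = 1`, `y · m = |m|`. [folklore] -/
private theorem exists_unit_mul_eq_norm (m : ℍ) : ∃ y : ℍ, ‖y‖ = 1 ∧ y * m = ((‖m‖ : ℝ) : ℍ) := by
  by_cases hm : m = 0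
  · exact ⟨1, norm_one, by simp [hm]⟩
  · have hn : ‖m‖ ≠ 0 := norm_ne_zero_iff.2 hm
    refine ⟨‖m‖⁻¹ • star m, ?_, ?_⟩
    · rw [norm_smul, norm_inv, norm_norm, Quaternion.norm_star, inv_mul_cancel₀ hn]
    · rw [smul_mul_assoc, Quaternion.star_mul_self, Quaternion.normSq_eq_norm_mul_self, Quaternion.coe_mul,
        ← Quaternion.coe_mul_eq_smul, ← mul_assoc, ← Quaternion.coe_mul, inv_mul_cancel₀ hn, Quaternion.coe_one,
        one_mul]

/-- The one-link potential `g ↦ 2 Re tr(g B)` (the `SU(2)` normalisation `N · Re tr`, `N = 2`). [folklore] -/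
def pot (B : M₂) : SU2 → ℝ := fun g => (2 : ℝ) * (((g : M₂) * B).trace.re)

/-- The potential in quaternion form: `2 Re tr(g B) = 4 Re(x_g · qp B)`. [cite: Creutz2022, Ch. 18 (18.13)–(18.15)] -/
theorem pot_eq (B : M₂) (g : SU2) : pot B g = 4 * (su2Quat g * qp B).re := by
  simp only [pot, re_trace_eq_two_mul_re]; ring

/-- The potential is continuous. [folklore] -/
private theorem continuous_pot (B : M₂) : Continuous (pot B) := continuous_const.mul (continuous_re_trace_su_mul B)

/-- `|2 Re tr(g B)| ≤ 2√2 ‖B‖_F` (Cauchy–Schwarz, from the tree's `abs_re_trace_su2_mul_le_frob`). [folklore] -/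
private theorem abs_pot_le (B : M₂) (g : SU2) : |pot B g| ≤ 2 * (Real.sqrt 2 * frobNorm B) := by
  simp only [pot]
  rw [abs_mul, abs_two]
  exact mul_le_mul_of_nonneg_left (abs_re_trace_su2_mul_le_frob g B) zero_le_two

/-- **The variance lemma.**  For the one-link law `ν_B = σ.tilted (2 Re tr(· B))` of `SU(2)` with `|2 Re tr(g B)| ≤ 1`
for all `g`, and the linear observable `w = 2 Re tr(· Δ)`:  `Var_{ν_B}(w) ≤ ∫ w² dσ` (`= Var_σ(w)`, `w` having Haar
mean zero).  Axis reduction by a right translation (Creutz (18.17)), isotropy of the transverse coordinates, and the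
two one-dimensional inequalities of Part B.2. [cite: Creutz2022, Ch. 18 (18.17)–(18.20)] -/
theorem integral_var_tilted_le (B Δ : M₂) (hB : ∀ g : SU2, |pot B g| ≤ 1) :
    ∫ s, (pot Δ s - ∫ s', pot Δ s' ∂(Measure.tilted σ₂ (pot B))) ^ 2 ∂(Measure.tilted σ₂ (pot B)) ≤
      ∫ s, pot Δ s ^ 2 ∂σ₂ := by
  obtain ⟨y, hy1, hy⟩ := exists_unit_mul_eq_norm (qp B)
  set κ : ℝ := 4 * ‖qp B‖ with hκ
  have hκ0 : 0 ≤ κ := by positivity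
  -- `κ = F(y) ≤ 1`
  have hκ1 : κ ≤ 1 := by
    have h := hB (unitSU2 y hy1)
    rw [pot_eq, su2Quat_unitSU2, hy, Quaternion.re_coe] at h
    exact (le_abs_self _).trans h
  set m' : ℍ := y * qp Δ with hm'
  have hnm' : Quaternion.normSq m' = Quaternion.normSq (qp Δ) := by
    rw [hm', map_mul, Quaternion.normSq_eq_norm_mul_self y, hy1, one_mul, one_mul]
  set a : ℝ := m'.re * κ with ha
  set ν : Measure SU2 := Measure.tilted σ₂ (pot B) with hν
  -- integrability and the normalisation
  have hFm : Measurable (pot B) := (continuous_pot B).measurable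
  have hwm : Measurable (pot Δ) := (continuous_pot Δ).measurable
  have hexpF : Integrable (fun s => exp (pot B s)) σ₂ :=
    integrable_of_measurable_of_abs_le hFm.exp (C := exp 1) fun s => by
      rw [abs_of_nonneg (exp_pos _).le]; exact exp_le_exp.2 ((le_abs_self _).trans (hB s))
  haveI : IsProbabilityMeasure ν := isProbabilityMeasure_tilted hexpF
  set Z : ℝ := ∫ s, exp (pot B s) ∂σ₂ with hZ
  have hZpos : 0 < Z := by
    rw [hZ]; exact integral_exp_pos hexpF
  -- Step 1: `Var_ν(w) ≤ E_ν (w − a)²`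
  have hXb : ∃ C, ∀ s, |pot Δ s - a| ≤ C := ⟨2 * (Real.sqrt 2 * frobNorm Δ) + |a|, fun s =>
    (abs_sub _ _).trans (add_le_add (abs_pot_le Δ s) le_rfl)⟩
  have h1 : ∫ s, (pot Δ s - ∫ s', pot Δ s' ∂ν) ^ 2 ∂ν ≤ ∫ s, (pot Δ s - a) ^ 2 ∂ν := by
    have h := integral_sub_avg_sq_le (μ := ν) (hwm.sub_const a) hXb
    have hwi : Integrable (pot Δ) ν := integrable_of_measurable_of_abs_le hwm (abs_pot_le Δ)
    have hmean : ∫ s', (pot Δ s' - a) ∂ν = (∫ s', pot Δ s' ∂ν) - a := by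
      rw [integral_sub hwi (integrable_const a), integral_const]; simp
    rw [hmean] at h
    have he : ∀ s, pot Δ s - a - ((∫ s', pot Δ s' ∂ν) - a) = pot Δ s - ∫ s', pot Δ s' ∂ν := fun s => by ring
    simp_rw [he] at h
    exact h
  -- Step 2: the tilted integral as a Haar integral
  have h2 : ∫ s, (pot Δ s - a) ^ 2 ∂ν = (∫ s, exp (pot B s) * (pot Δ s - a) ^ 2 ∂σ₂) / Z := by
    rw [hν, integral_tilted]
    simp_rw [smul_eq_mul, div_mul_eq_mul_div]
    exact integral_div _ _
  -- Step 3: axis reduction by the right translation `x ↦ x · y`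
  have hre : ∀ x : ℍ, (x * y * qp B).re = x.re * ‖qp B‖ := fun x => by
    rw [mul_assoc, hy, Quaternion.re_mul]
    simp
  have hexp : ∀ x : ℍ, exp (4 * (x.re * ‖qp B‖)) = exp (κ * x.re) := fun x => by
    rw [hκ]; ring_nf
  have h3 : ∫ s, exp (pot B s) * (pot Δ s - a) ^ 2 ∂σ₂ =
      16 * ∫ g, ((su2Quat g * m').re - m'.re * κ / 4) ^ 2 * exp (κ * (su2Quat g).re) ∂σ₂ := by
    have h := integral_comp_unit_right (fun x : ℍ => exp (4 * (x * qp B).re) * (4 * (x * qp Δ).re - a) ^ 2) hy1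
    have hl : ∀ g : SU2, exp (4 * (su2Quat g * y * qp B).re) * (4 * (su2Quat g * y * qp Δ).re - a) ^ 2 =
        16 * (((su2Quat g * m').re - m'.re * κ / 4) ^ 2 * exp (κ * (su2Quat g).re)) := fun g => by
      have e1 : (su2Quat g * y * qp Δ).re = (su2Quat g * m').re := by rw [hm', mul_assoc]
      rw [hre, hexp, e1, ha]
      ring
    simp only [hl] at h
    rw [integral_const_mul] at h
    simp only [pot_eq]
    exact h.symm
  have hZ' : Z = ∫ g, exp (κ * (su2Quat g).re) ∂σ₂ := by
    have h := integral_comp_unit_right (fun x : ℍ => exp (4 * (x * qp B).re)) hy1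
    simp only [hre, hexp] at h
    rw [hZ]
    simp only [pot_eq]
    exact h.symm
  -- Step 4: the core inequality
  have h4 := integral_sq_sub_mul_exp_le hκ0 hκ1 m'
  rw [← hZ', hnm'] at h4
  -- Step 5: assemble
  have hw2 : ∫ s, pot Δ s ^ 2 ∂σ₂ = 4 * Quaternion.normSq (qp Δ) := integral_sq_two_mul_re_trace Δ
  rw [hw2]
  refine h1.trans ?_
  rw [h2, h3, div_le_iff₀ hZpos]
  nlinarith [h4, hZpos.le]

end Variance

/-! ## Part C: the one-link KR modulus of `SU(2)` without the tilt factor -/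

section Modulus

/-- **The one-link KR modulus of `SU(2)` at constant `K(R)² = 2/(1 − 2R)`.**  For `R ≤ 1/4`:
`OneLinkKRModulus 2 R (√(2/(1 − 2R)))`, i.e. for `‖B‖_op, ‖B'‖_op ≤ R` and `L`-Lipschitz `φ` (Frobenius distance on
`SU(2)`), `|ν_B(φ) − ν_{B'}(φ)| ≤ K(R) · L · ‖B − B'‖_F`.  The proof is the covariance interpolation of the tree's
`oneLinkKRModulus_su2` (SZZ's Dobrushin route, METHOD only: arXiv:2204.12737 p. 6, the unnumbered remark after Rem. 1.3) with ONE
change: the variance of the perturbing potential `w = 2 Re tr(g(B' − B))` under the interpolated one-link law is now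
bounded by its Haar variance (`integral_var_tilted_le`, `Var_{ν_{B_t}}(w) ≤ ∫ w² dσ ≤ 2‖B' − B‖_F²`) instead of
`c(R) ∫ w² dσ`, `c(R) = 1 + 8R² + 128R³/9`.  At `R = 1/6` (Wilson `β_W = 1/9`): `K = √3 = 1.7321` against `1.9658`
(tree, `oneLinkKRModulus_su2`) and `3` (Bakry–Émery alone). [cite: arXiv220412737, unnumbered remark p. 6 (after Rem. 1.3; Dobrushin route) with Thm. 1.2 (Uniqueness and ergodicity)] -/
theorem oneLinkKRModulus_su2_var {R : ℝ} (hR : R ≤ 1 / 4) :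
    OneLinkKRModulus 2 R (Real.sqrt (2 / (1 - 2 * R))) := by
  classical
  intro B B' hB hB' φ L hφm hφb hL hφL
  set Kc : ℝ := Real.sqrt (2 / (1 - 2 * R)) with hKc
  have h12 : 0 < 1 - 2 * R := by linarith
  have h12' : (1 - 2 * R) ≠ 0 := h12.ne'
  have hKc0 : 0 ≤ Kc := Real.sqrt_nonneg _
  have hKc2 : Kc ^ 2 = 2 / (1 - 2 * R) := Real.sq_sqrt (by positivity)
  have h2 : ((2 : ℕ) : ℝ) = 2 := by norm_num
  rw [h2]
  -- the potentials, with the real numeral `2`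
  set f : SU2 → ℝ := fun g => (2 : ℝ) * (((g : M₂) * B).trace.re) with hf
  set w : SU2 → ℝ := fun g => (2 : ℝ) * (((g : M₂) * (B' - B)).trace.re) with hw
  have hfw : (fun g : SU2 => (2 : ℝ) * (((g : M₂) * B').trace.re)) = fun g => f g + w g := by
    funext g
    simp only [hf, hw, Matrix.mul_sub, Matrix.trace_sub, Complex.sub_re]
    ring
  rw [hfw, abs_sub_comm]
  have hfm : Measurable f := (continuous_const.mul (continuous_re_trace_su_mul B)).measurable
  have hwm : Measurable w := (continuous_const.mul (continuous_re_trace_su_mul (B' - B))).measurable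
  have hfb : ∃ C, ∀ s, |f s| ≤ C := ⟨2 * (2 * matrixOpNorm B), fun s => by
    simp only [hf]
    rw [abs_mul, abs_two]
    exact mul_le_mul_of_nonneg_left (abs_re_trace_su2_mul_le_opNorm s B) zero_le_two⟩
  set Bw : ℝ := 2 * (Real.sqrt 2 * frobNorm (B' - B)) with hBw
  have hwb : ∀ s, |w s| ≤ Bw := fun s => by
    simp only [hw, hBw]
    rw [abs_mul, abs_two]
    exact mul_le_mul_of_nonneg_left (abs_re_trace_su2_mul_le_frob s _) zero_le_two
  have key := abs_integral_tilted_add_sub_le_of_cov (μ := σ₂) (A := Kc * L * frobNorm (B' - B))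
    hfm hfb hwm hwb hφm hφb ?_
  · rw [frobNorm_sub_comm]; exact key
  · intro t ht
    -- the interpolated tilt is the one-link law at `B_t`, `‖B_t‖_op ≤ R`
    set Bt : M₂ := B + (t : ℂ) • (B' - B) with hBt
    have hft : (fun u : SU2 => f u + t * w u) = pot Bt := by
      funext g
      simp only [hf, hw, hBt, pot, Matrix.mul_add, Matrix.mul_smul, Matrix.trace_add, Matrix.trace_smul,
        Complex.add_re, smul_eq_mul, Complex.re_ofReal_mul]
      ring
    have hBt_le : matrixOpNorm Bt ≤ R := by
      have h1 : Bt = ((1 - t : ℝ) : ℂ) • B + ((t : ℝ) : ℂ) • B' := by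
        rw [hBt]
        push_cast
        simp only [smul_sub, sub_smul, one_smul]
        abel
      rw [h1]
      calc matrixOpNorm (((1 - t : ℝ) : ℂ) • B + ((t : ℝ) : ℂ) • B')
          ≤ matrixOpNorm (((1 - t : ℝ) : ℂ) • B) + matrixOpNorm (((t : ℝ) : ℂ) • B') := matrixOpNorm_add_le _ _
        _ = (1 - t) * matrixOpNorm B + t * matrixOpNorm B' := by
            rw [matrixOpNorm_smul, matrixOpNorm_smul, Complex.norm_real, Complex.norm_real, Real.norm_eq_abs,
              Real.norm_eq_abs, abs_of_nonneg (by linarith [ht.2]), abs_of_nonneg ht.1]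
        _ ≤ (1 - t) * R + t * R :=
            add_le_add (mul_le_mul_of_nonneg_left hB (by linarith [ht.2])) (mul_le_mul_of_nonneg_left hB' ht.1)
        _ = R := by ring
    have hBt_lt : matrixOpNorm Bt < 1 / 2 := by linarith
    rw [hft]
    set ν : Measure SU2 := Measure.tilted σ₂ (pot Bt) with hν
    have hFm : Measurable (pot Bt) := (continuous_pot Bt).measurable
    have hFκ : ∀ s, |pot Bt s| ≤ 4 * R := fun s => by
      simp only [pot]
      rw [abs_mul, abs_two]
      calc 2 * |((s : M₂) * Bt).trace.re| ≤ 2 * (2 * matrixOpNorm Bt) :=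
            mul_le_mul_of_nonneg_left (abs_re_trace_su2_mul_le_opNorm s Bt) zero_le_two
        _ ≤ 4 * R := by linarith
    have hexpF : Integrable (fun s => exp (pot Bt s)) σ₂ :=
      integrable_of_measurable_of_abs_le hFm.exp (C := exp (4 * R)) fun s => by
        rw [abs_of_nonneg (exp_pos _).le]; exact exp_le_exp.2 ((le_abs_self _).trans (hFκ s))
    haveI : IsProbabilityMeasure ν := isProbabilityMeasure_tilted hexpF
    -- the variance of the observable: the tree's Bakry–Émery theorem
    have hVφ : ∫ s, (φ s - ∫ s', φ s' ∂ν) ^ 2 ∂ν ≤ L ^ 2 / (1 - 2 * R) := by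
      have hvar := SUNBakryEmery.haarPoincare_SU (N := 2) le_rfl Bt hBt_lt φ L hL hφL
      rw [h2, variance_eq_integral hφm.aemeasurable] at hvar
      refine hvar.trans ?_
      exact div_le_div_of_nonneg_left (sq_nonneg L) h12 (by linarith)
    -- the variance of the perturbation: at most its Haar variance (Part B)
    have hw2 : ∀ s : SU2, w s ^ 2 = 4 * (((s : M₂) * (B' - B)).trace.re) ^ 2 := fun s => by
      simp only [hw]; ring
    have hEσ : ∫ s, w s ^ 2 ∂σ₂ ≤ 2 * frobNorm (B' - B) ^ 2 := by
      simp_rw [hw2]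
      rw [integral_const_mul, integral_sq_re_trace_su2_mul]
      linarith [coef_sq_le (B' - B)]
    have h4R : 4 * R ≤ 1 := by linarith
    have hB1 : ∀ g : SU2, |pot Bt g| ≤ 1 := fun g => (hFκ g).trans h4R
    have hVw : ∫ s, (w s - ∫ s', w s' ∂ν) ^ 2 ∂ν ≤ (Kc * (1 - 2 * R) * frobNorm (B' - B)) ^ 2 / (1 - 2 * R) := by
      have hM : (Kc * (1 - 2 * R) * frobNorm (B' - B)) ^ 2 / (1 - 2 * R) = 2 * frobNorm (B' - B) ^ 2 := by
        rw [mul_pow, mul_pow, hKc2]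
        field_simp
      rw [hM]
      have hV := integral_var_tilted_le Bt (B' - B) hB1
      exact hV.trans hEσ
    -- Cauchy–Schwarz
    have hcov := abs_integral_mul_sub_le_of_variance_le (ν := ν) h12 hL
      (mul_nonneg (mul_nonneg hKc0 h12.le) (frobNorm_nonneg _)) hφm hφb hwm ⟨Bw, hwb⟩ hVφ hVw
    refine hcov.trans (le_of_eq ?_)
    field_simp

end Modulus

/-! ## Part D: the `SU(2)`, `d = 4` window `81 β_W² + 6 β_W < 2` (`β_W < 0.124404`), hypothesis-free, in the three
currencies SC-a (DLR), SC-b (torus clustering), SC-c (transfer-operator gap) -/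

section Window

/-- The modulus in Wilson units (`R = 3β_W/2`, `K = 4K₂`): for `β_W ≤ 1/6`,
`OneLinkKRModulusSU2 β_W (√(2/(1 − 3β_W)) / 4)`. [cite: arXiv220412737, unnumbered remark p. 6 (after Rem. 1.3; Dobrushin route)] -/
theorem oneLinkKRModulusSU2_var {βW : ℝ} (h6 : βW ≤ 1 / 6) :
    OneLinkKRModulusSU2 βW (Real.sqrt (2 / (1 - 3 * βW)) / 4) := by
  have h := oneLinkKRModulus_su2_var (R := 3 * βW / 2) (by linarith)
  have e2 : (1 - 2 * (3 * βW / 2)) = 1 - 3 * βW := by ring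
  rw [e2] at h
  unfold OneLinkKRModulusSU2
  convert h using 2
  ring

/-- The window implies `β_W < 1/6`. [folklore] -/
private theorem lt_sixth_of_window {βW : ℝ} (h0 : 0 ≤ βW) (hwin : 81 * βW ^ 2 + 6 * βW < 2) : βW < 1 / 6 := by
  nlinarith

/-- **The window inequality.**  For `0 ≤ β_W` with `81 β_W² + 6 β_W < 2` (`β_W < (√684 − 6)/162 = 0.124404…`) the
Dobrushin constant `18 β_W K₂ = (9β_W/2) √(2/(1 − 3β_W))` is `< 1`. [cite: arXiv220412737, unnumbered remark p. 6 (after Rem. 1.3; Dobrushin route)] -/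
theorem su2_window_var {βW : ℝ} (h0 : 0 ≤ βW) (hwin : 81 * βW ^ 2 + 6 * βW < 2) :
    18 * βW * (Real.sqrt (2 / (1 - 3 * βW)) / 4) < 1 := by
  have h13 : 0 < 1 - 3 * βW := by linarith [lt_sixth_of_window h0 hwin]
  rcases h0.eq_or_lt with h | hpos
  · rw [← h]; norm_num
  · have hX : 2 / (1 - 3 * βW) < (2 / (9 * βW)) ^ 2 := by
      rw [div_pow, div_lt_div_iff₀ h13 (by positivity)]
      nlinarith [hwin]
    have hs : Real.sqrt (2 / (1 - 3 * βW)) < 2 / (9 * βW) := by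
      rw [Real.sqrt_lt' (by positivity)]; exact hX
    calc 18 * βW * (Real.sqrt (2 / (1 - 3 * βW)) / 4) = (9 * βW / 2) * Real.sqrt (2 / (1 - 3 * βW)) := by ring
      _ < (9 * βW / 2) * (2 / (9 * βW)) := mul_lt_mul_of_pos_left hs (by positivity)
      _ = 1 := by field_simp

/-- **SC-b, hypothesis-free**: for `0 ≤ β₀W` with `81 β₀W² + 6 β₀W < 2`,
`StrongCouplingFront (fundamentalLatticeRep 2) (β₀W/2)` — volume-uniform exponential clustering of Wilson loops on
every torus `(ℤ/Lℤ)⁴`, at every Wilson coupling `≤ β₀W`. [cite: arXiv220412737, unnumbered remark p. 6 (after Rem. 1.3; Dobrushin route) with Thm. 1.2 (Uniqueness and ergodicity) and Cor. 1.6 (Mass gap)] -/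
theorem su2_strongCouplingFront_var {β₀W : ℝ} (h0 : 0 ≤ β₀W) (hwin : 81 * β₀W ^ 2 + 6 * β₀W < 2) :
    CrossoverLedger.StrongCouplingFront (fundamentalLatticeRep 2) (β₀W / 2) :=
  su2_strongCouplingFront_of_oneLinkKRModulus (by positivity)
    (oneLinkKRModulusSU2_var (lt_sixth_of_window h0 hwin).le) (su2_window_var h0 hwin)

/-- **The `SU(2)`, `d = 4` strong-coupling front holds up to Wilson `β_W = 0.124`, hypothesis-free** (printed
window `β_W < 1/12`; tree before this file `β_W ≤ 0.1124`).  Observatory of the non-perturbative crossover; no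
mass-gap claim. [cite: arXiv220412737, unnumbered remark p. 6 (after Rem. 1.3; Dobrushin route) with Thm. 1.2 (Uniqueness and ergodicity) and Cor. 1.6 (Mass gap)] -/
theorem su2_strongCouplingFront_124 :
    CrossoverLedger.StrongCouplingFront (fundamentalLatticeRep 2) ((31 / 250 : ℝ) / 2) :=
  su2_strongCouplingFront_var (by norm_num) (by norm_num)

/-- **SC-a, hypothesis-free**: for `0 ≤ β_W` in the window, the `SU(2)` Wilson DLR specification on `ℤ⁴` at `β_W`
has a unique Gibbs measure and exponential clustering of Lipschitz cylinder covariances at rate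
`−log max(18 β_W K₂(β_W), 1/2)`, `K₂(β_W) = √(2/(1 − 3β_W))/4`. [cite: Follmer1988, Ch. I Theorem (2.13)] -/
theorem su2_dlrMassGap_var {βW : ℝ} (h0 : 0 ≤ βW) (hwin : 81 * βW ^ 2 + 6 * βW < 2) :
    HasUniqueGibbsMeasure (ymSpecification (d := 4) (fundamentalRep (Fin 2)) (2 * (βW / 4))) ∧
      DLRClusteringAt 4 2 (βW / 4) (-Real.log (max (18 * βW * (Real.sqrt (2 / (1 - 3 * βW)) / 4)) (1 / 2))) :=
  su2_dlrMassGap_of_oneLinkKRModulus h0 (by positivity) (oneLinkKRModulusSU2_var (lt_sixth_of_window h0 hwin).le)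
    (su2_window_var h0 hwin)

/-- SC-a below a window point: `0 ≤ β_W ≤ β₀W`, `β₀W` in the window ⇒ `DLRMassGapAt 4 2 (β_W/4)`.
[cite: Follmer1988, Ch. I Theorem (2.13)] -/
theorem su2_dlrMassGapAt_var {β₀W βW : ℝ} (h0 : 0 ≤ βW) (hle : βW ≤ β₀W) (hwin : 81 * β₀W ^ 2 + 6 * β₀W < 2) :
    DLRMassGapAt 4 2 (βW / 4) :=
  su2_dlrMassGapAt_of_le h0 hle (by positivity)
    (oneLinkKRModulusSU2_var (lt_sixth_of_window (h0.trans hle) hwin).le)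
    (su2_window_var (h0.trans hle) hwin)

/-- **The `SU(2)`, `d = 4` DLR mass gap (unique Gibbs state, exponential clustering) holds for every Wilson
`0 ≤ β_W ≤ 0.124`, hypothesis-free** (printed window `β_W < 1/12`; tree before this file `β_W ≤ 0.1124`).
Observatory of the non-perturbative crossover; no mass-gap claim beyond the strong-coupling regime stated.
[cite: Follmer1988, Ch. I Theorem (2.13)] -/
theorem su2_dlrMassGapAt_124 {βW : ℝ} (h0 : 0 ≤ βW) (h : βW ≤ 31 / 250) : DLRMassGapAt 4 2 (βW / 4) :=
  su2_dlrMassGapAt_var h0 h (by norm_num)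

/-- **SC-c, hypothesis-free**: for `0 ≤ β_W` in the window, the transfer-operator mass gap
`LatticeMassGap (fundamentalRep (Fin 2)) (β_W/2) (krRate (18 β_W K₂(β_W)))`, uniformly in the spatial volume.
[cite: arXiv220412737, unnumbered remark p. 6 (after Rem. 1.3; Dobrushin route) with Thm. 1.2 (Uniqueness and ergodicity) and Cor. 1.6 (Mass gap)] -/
theorem su2_latticeMassGap_var {βW : ℝ} (h0 : 0 ≤ βW) (hwin : 81 * βW ^ 2 + 6 * βW < 2) :
    CrossoverLedger.LatticeMassGap (fundamentalRep (Fin 2)) (βW / 2)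
      (krRate (18 * βW * (Real.sqrt (2 / (1 - 3 * βW)) / 4))) :=
  su2_latticeMassGap_of_oneLinkKRModulusSU2 h0 (by positivity)
    (oneLinkKRModulusSU2_var (lt_sixth_of_window h0 hwin).le) (su2_window_var h0 hwin)

/-- **SC-c at `β_W = 0.124`** (tree coupling `0.062`). [cite: arXiv220412737, unnumbered remark p. 6 (after Rem. 1.3; Dobrushin route) with Thm. 1.2 (Uniqueness and ergodicity) and Cor. 1.6 (Mass gap)] -/
theorem su2_latticeMassGap_124 :
    CrossoverLedger.LatticeMassGap (fundamentalRep (Fin 2)) ((31 / 250 : ℝ) / 2)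
      (krRate (18 * (31 / 250 : ℝ) * (Real.sqrt (2 / (1 - 3 * (31 / 250 : ℝ))) / 4))) :=
  su2_latticeMassGap_var (by norm_num) (by norm_num)

/-- **SC-c at the ledger value `β_W = 1/9` with the improved rate**: Dobrushin constant `√3/2 = 0.8660`
(tree: `√(313/324) = 0.9829`), `krRate = ½ log(4/3) = 0.1438` (tree: `0.01727`).
[cite: arXiv220412737, unnumbered remark p. 6 (after Rem. 1.3; Dobrushin route) with Thm. 1.2 (Uniqueness and ergodicity) and Cor. 1.6 (Mass gap)] -/
theorem su2_latticeMassGap_ninth_var :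
    CrossoverLedger.LatticeMassGap (fundamentalRep (Fin 2)) ((1 / 9 : ℝ) / 2)
      (krRate (18 * (1 / 9 : ℝ) * (Real.sqrt (2 / (1 - 3 * (1 / 9 : ℝ))) / 4))) :=
  su2_latticeMassGap_var (by norm_num) (by norm_num)

/-- **SC-c at `β_W = 1/9` with the rate in closed form**: `LatticeMassGap (fundamentalRep (Fin 2)) (1/18) (½ log(4/3))`
(`½ log(4/3) = 0.14384`; the Dobrushin constant is `√3/2`).
[cite: arXiv220412737, unnumbered remark p. 6 (after Rem. 1.3; Dobrushin route) with Thm. 1.2 (Uniqueness and ergodicity) and Cor. 1.6 (Mass gap)] -/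
theorem su2_latticeMassGap_ninth_rate :
    CrossoverLedger.LatticeMassGap (fundamentalRep (Fin 2)) ((1 / 9 : ℝ) / 2) (Real.log (4 / 3) / 2) := by
  have h3 : Real.sqrt (2 / (1 - 3 * (1 / 9 : ℝ))) = Real.sqrt 3 := by norm_num
  have hc : 18 * (1 / 9 : ℝ) * (Real.sqrt (2 / (1 - 3 * (1 / 9 : ℝ))) / 4) = Real.sqrt 3 / 2 := by
    rw [h3]; ring
  have hs1 : (1 : ℝ) ≤ Real.sqrt 3 := by
    rw [show (1 : ℝ) = Real.sqrt 1 by simp]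
    exact Real.sqrt_le_sqrt (by norm_num)
  have hrate : krRate (Real.sqrt 3 / 2) = Real.log (4 / 3) / 2 := by
    unfold krRate
    rw [max_eq_left (by linarith), Real.log_div (by positivity) (by norm_num), Real.log_sqrt (by norm_num),
      Real.log_div (by norm_num) (by norm_num), show (4 : ℝ) = 2 ^ 2 by norm_num, Real.log_pow]
    push_cast
    ring
  have h := su2_latticeMassGap_ninth_var
  rw [hc, hrate] at h
  exact h

end Window

end

end Literature.MathematicalPhysics.QuantumFieldTheory.Balaban1983to89.StrongCouplingVarianceWindow
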